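import Mathlib.Analysis.Calculus.Gradient.Basic
import Literature.Topology.FourManifolds.LefschetzHandlebody
import Literature.Topology.FourManifolds.TorusCoordinates
import Literature.Geometry.Symplectic.PlanarContactBoundary
import Literature.Geometry.Symplectic.SteinDomain
import HarnessLib

/-!
# PALF ⇒ Stein, with the boundary contact structure supported by the Kas open book
# (Akbulut–Ozbagci 2001 Thm. 5 + Gay 2002 Prop. 2.8; Baykur 2006 p. 14; Etnyre 2006 Thm. 5.6)

Topic `Literature/Geometry/Symplectic` (sibling of `LefschetzSteinRealisation.lean`).  ONE named fact,
`palf_stein_supportedByBoundaryOpenBook` (a `def … : Prop`, NOT proved here), and the four small pieces of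
vocabulary its statement needs over the tree's concrete Lefschetz handlebodies
(`Literature/Topology/FourManifolds/LefschetzHandlebody.lean`: `Base g ⊂ ℂ²`, pages `page g c`, `shadow`,
`pageTwisting`, Kosinski multi-attachments `MultiAttachmentData`): `det4` (volume form of `ℝ⁴ = ℂ²`),
`ambientC` (tangent vectors of the cores-complement read in `ℝ⁴`), `IsPosBdryFrame` (positive frames of
`∂ Base g` for the boundary orientation of the complex orientation), `IsKasOpenBookOf` (Prop-spec: an
`OpenBook` on the seam IS the Kas boundary open book of the Lefschetz handlebody — binding = image of the
base binding `w = 0`, fibration = page angle `w/‖w‖` on the unsurgered part).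

Why this fact (crux `ConvexBisection.AcyclicBisectionExists`, line `modp-braid-orbits`, lead c5, design
`Cruxes/AcyclicBisectionExists/NF6-Assembly-Design.lean`): the named fact
`steinRealisation_of_sorted_modelsOnFibred` (Baykur's Thm. 5.1 proof, `LefschetzSteinRealisation.lean`) is
ASSEMBLED in Lean from (T1) page rotation + link transport (proved:
`Summits/…/Theorems/ConvexBisectionAcyclicBisectionExistsPrefixHandlebody.lean`), (T2) the complement piece
(proved, `…SplitComplement.lean`), (T3) the dual Lefschetz presentation of the complement piece (topology, in
progress), (KOB) the Kas open book of a seam page function (construction, in progress), (S3) orientation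
propagation on the connected seam (in progress) and exactly ONE contact-topological input — this fact,
applied to both pieces with the SAME open book.  It is the published input Baykur quotes ("By PALF, both
`X₊` and `−X₋` admit Stein structures … as shown by Gay, the new open book on `∂Xᵢ` will be compatible with
the new induced contact structure"); its own proof (Torisu's convexity of `F × D²`, the Legendrian
realisation principle on pages, Eliashberg's Stein 2-handle `Gompf1998_thm13_twoHandles`, Gay's Prop. 2.8)
is far below the tree's proved depth and is NOT attempted here.

Faithfulness of the rendering (details in the docstrings): hypotheses = "`X` is a positive allowable
Lefschetz fibration over `D²` with bounded fibre `F_{g,1}`" in Kas' handlebody form (each 2-handle along a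
curve in a page with framing page `−1` and non-separating ⟺ non-zero class; the cyclic order of the pages is
irrelevant to the theorem, so no `pageDir` clause); "its boundary open book" = `IsKasOpenBookOf` (the pair
`(B, π)` is determined on the dense unsurgered part; Giroux's conditions see the tubes only through
`(B, π)`); conclusion = a Stein structure whose complex tangencies are in Giroux form for that open book
(Etnyre's "supported after an isotopy of `ξ`" absorbed into the choice of `S` by Gray's theorem and isotopy
extension) and POSITIVE for the complex boundary orientation (Baykur 2006 §2.3) — the same `(B, π)` supports
one positive contact structure for each orientation of the seam, so this clause is content.

## Review under the fact-decomposition discipline (D-0026/D-0027, 2026-08-17): kept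

Two discharge seats triaged the fact XL and ended `blocked-on: Gompf1998_thm13_twoHandles` (E2,
`SteinTwoHandles.lean`, itself kept as an irreducibly XL named fact by the review of 2026-08-15 recorded
there), so the fact came up for review as a decomposition child: provable inline, mis-cut (restate /
merge), or not in the sources?  Findings, with the sources open (Akbulut–Ozbagci 2001, arXiv:math/0012239,
§2 and the proof of the main theorem, p. 8; Etnyre 2006, arXiv:math/0409402, Def. 3.2, Thms. 5.4–5.5 and
the proof of Thm. 5.6; Gay 2002, arXiv:math/0104059, Def. 2.1, Thm. 2.2, Prop. 2.8; Baykur 2006,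
arXiv:math/0601396, proof of Thm. 5.1, p. 14):

* **In the sources.**  The statement is the induction printed three times.  Akbulut–Ozbagci, proof of
  Thm. 5, converse direction: *"let `X` be a PALF, then it is obtained by a sequence of steps of attaching
  2-handles `X₀ = D² × F ⤳ X₁ ⤳ ⋯ ⤳ Xₙ = X`, where each `X_{i−1}` is a PALF and `Xᵢ` is obtained from
  `X_{i−1}` by attaching a 2-handle to a nonseparating curve `C` lying on a fiber `F ⊂ ∂X_{i−1}` … with
  the framing `k − 1`, where `k` is the framing induced from the surface `F`. Inductively we assume that
  `X_{i−1}` has a Stein structure, with a convex fiber `F ⊂ ∂X_{i−1}`. By [Torisu] we can start the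
  induction … By the 'Legendrian realization principle' of [Honda] … `k` can be taken to be the
  Thurston–Bennequin framing, and then the result follows by Eliashberg's theorem"*.  Baykur, p. 14, the
  same induction with the compatibility clause: *"Assume that the PALF on `X_{i−1}` … induces an open book
  decomposition on its boundary, and it carries a Stein structure such that the contact structure induced
  on the boundary is compatible with this open book … By Eliashberg the Stein structure extends over this
  handle, and as shown by Gay in [Ga], the new open book on `∂Xᵢ` will be compatible with the new induced
  contact structure on `∂Xᵢ`. This completes the induction."*  Etnyre, proof of Thm. 5.6, "⇐": the Stein
  filling of `(M_{(Σ,id)}, ξ_{(Σ,id)})`, Legendrian realisation of a non-separating `γ` on a page, then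
  Thm. 5.4 (Eliashberg 1990 / Weinstein 1991: a 2-handle along a Legendrian `L` with framing one less
  than the contact framing turns a Stein filling of `(M, ξ)` into a Stein filling of
  `(M_{(L,−1)}, ξ_{(L,−1)})`) and Thm. 5.5 (`(M, ξ)_{(L,−1)} = (M_{(Σ, φ∘D_L⁺)}, ξ_{(Σ, φ∘D_L⁺)})` for `L`
  Legendrian on a page; = Gay, Prop. 2.8: *"`𝔅(Σ,h) ≺ 𝔅(Σ,h ∘ τ_C)` … the cobordism is … a 4-dimensional
  2-handle attached along `C ⊂ Σ × {t}` with framing `pf(C) − 1`"*, `C` homologically nontrivial).  The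
  allowability hypothesis is Akbulut–Ozbagci's (§2: *"allowable iff all its vanishing cycles are
  homologically non-trivial in the fiber `F`. Note that a simple closed curve on a surface is
  homologically trivial iff it separates the surface"*) = Gay's "homologically nontrivial curve
  `C ⊂ Σ ∖ ∂Σ`" = Etnyre's *"we required `γ` to be non-separating so that we could use the Legendrian
  realization principle"*.  Akbulut–Ozbagci 2001 has an erratum (Geom. Topol. 5 (2001), 939–945,
  doi:10.2140/gt.2001.5.939; not held, acquisition request acq-07239); the direction used here is
  independently Etnyre's proof of Thm. 5.6 and Loi–Piergallini 2001, Thm. 1, so the provenance does not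
  rest on the erratum's scope.  The `[cite]` tags of the fact now also name Etnyre Thms. 5.4–5.6 and Gay
  Prop. 2.8 (Akbulut–Ozbagci Thm. 5 prints the Stein structure but not the compatibility clause); the
  Lean statement is unchanged.
* **Faithfully rendered** — audit of the tree conventions the statement rests on
  (`LefschetzBasePages.lean` §§5–7, `LefschetzBaseModel.lean` §2, this file).  (1) POSITIVE:
  `pageTwisting = −1` is the winding number of the handle framing in the normal frame `(iK', n)` of the
  attaching circle in `∂ Base g`; along the pages `∇rho = 2 w (ā, b̄)` (`dw = a dx + b dy`) is the outward
  normal and `n = horizNormal = i ∇rho / (2(‖a‖² + ‖b‖²))` is `J` of it, `(K', iK', ν_out, i ν_out)` is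
  complex-positive and `(ν_out, K', iK', n)` an even permutation of it, so `(K', iK', n)` is positive for
  the boundary orientation of the COMPLEX orientation of `Base g ⊂ ℂ²`; and winding number `k` in the
  positively oriented normal plane is framing coefficient `+k` relative to the page framing (check on the
  round unknot in `ℝ³`: one turn of the framing in the oriented normal plane `(e_z, e_r)` gives a push-off
  of linking number `+1`).  So `−1` is "one less than the framing induced by the fibre" for the
  orientation in which the fibration `w` is holomorphic — a POSITIVE Lefschetz handle — and the PALF
  orientation of `X` is the complex orientation of the base, the one the positivity clause refers to
  (`IsPosBdryFrame`: `det(∇rho, v₀, v₁, v₂) > 0` in the coordinates `(Re x, Im x, Re y, Im y)`).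
  (2) ALLOWABLE: `shadow ≠ 0` is `[K] ≠ 0` in `H₁(Base g; ℤ) ≅ ℤ^{2g}` (through `shadowMap`, a bijection
  once its `Classical.epsilon` specification — Milnor's Thm. 9.1 for the model — holds), and
  `page ↪ Base g` is an `H₁`-isomorphism on paper (the flat part `{‖x‖ < 2}` of the base is the union of
  the curves `{w = c'}`, `‖c'‖ ≤ 1/2`, over `‖x‖ < 2`, all diffeomorphic to the page since the `2g + 1`
  branch points of each have `‖x‖^{2g+1} ≤ 3/2`, and the part over `‖x‖ ≥ 2` retracts onto the part over
  `‖x‖ = 2`); for the embedded attaching circle this is "homologically non-trivial in the fibre" =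
  non-separating.  (3) HANDLES IN PAGES: several attaching circles may lie in one page (disjoint:
  `MultiAttachmentData.disjoint`); the printed induction covers this verbatim — after the first surgery
  the next circle still lies on a page of the new open book with the same page framing (Etnyre, proof of
  Thm. 5.5: `Σ_φ ∖ N = Σ_{φ∘D} ∖ N'`) — and the cyclic order of the pages is irrelevant to the conclusion.
  (4) THE OPEN BOOK: `IsKasOpenBookOf` pins the binding and, on the dense unsurgered part hence (by
  continuity) everywhere off the binding, the fibration `π = w/‖w‖`; two open books with the same
  `(B, π)` have the same Giroux forms — PROVED, `OpenBook.IsGirouxForm.of_binding_eq_of_proj_eq`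
  (`OpenBookGirouxFormTransfer.lean`) — so quantifying over all such `ob` adds nothing, and `(B, π)` is
  the boundary open book of the Lefschetz fibration as printed (Etnyre 2006, §2: binding `∂π⁻¹(x)`,
  fibration the restriction of the fibration map, i.e. `f/‖f‖`); `OpenBook.Supports` being invariant
  under reversing `π` (`α ↦ −α`), the sense of `π` carries no risk.  (5) "SUPPORTED": Etnyre's Def. 3.2
  allows an isotopy of `ξ`, the conclusion asks for a Giroux form of `ξ = boundaryPlaneField S.J bX`
  itself; equivalent, because only the existence of `S` is asserted (an isotopy `ψ_t` of `∂X` extends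
  over a collar to a diffeomorphism `Ψ` of `X`, and `Ψ_* S` is a Stein structure with complex tangencies
  `(ψ₁)_* ξ`).  (6) POSITIVITY: the contact structure of a strictly pseudoconvex boundary is positive for
  the boundary orientation of the complex orientation (Cieliebak–Eliashberg 2012, Ch. 2), and
  Eliashberg's construction yields the Stein structure on `X` with its PALF orientation (Gompf 1998,
  Thm. 1.3: "smooth, oriented, compact"), which by (1) is the complex orientation of the base.
  NON-VACUITY: the hypotheses are inhabited for every `g` by the handle-free base and its boundary open
  book (`exists_multiAttachmentData_isKasOpenBookOf_base`, `LefschetzSteinOpenBookBaseCase.lean`), so a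
  discharge must construct a Stein structure and a Giroux form; no degenerate case proves it.  Verdict:
  not mis-stated, not an open problem; nothing to restate beyond the cite tags.
* **Not mis-cut.**  It is the single black box that Baykur's proof of Thm. 5.1 invokes (*"By [PALF ⇔
  Stein], both `X₊` and `−X₋` admit Stein structures … as shown by Gay … compatible"*), stated once for a
  PALF and used twice — for `X₁` and for `W₂` (Baykur's `−X₋`), with the SAME open book — by the proved
  assembly `Summit.SmoothPoincare4.SmoothPoincare4.Theorems.AcyclicBisectionExists.ModpBraidOrbits.steinRealisation_of_nodes`
  (`Summits/SmoothPoincare4/SmoothPoincare4/Theorems/ConvexBisectionAcyclicBisectionExistsSteinRealisationReduction.lean`).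
  Merging it back would move an unprovable contact-topological obligation into a Summit theorem file;
  splitting it along its printed proof would mint at least three new named facts (base case, Legendrian
  realisation on pages, compatibility of the surgered open book) next to E2 — barred (decompositions do
  not recurse, D-0026).  Its planar-page twin `planarLefschetzBody_stein_supported`
  (`PlanarSteinDictionary.lean`) is the same printed theorem in the planar word vocabulary; neither
  renders the other, both stay.
* **Irreducibly XL; `blocked-on: E2` understates the gap.**  The printed proof needs, none of it in
  Mathlib or the tree: (i) the BASE CASE — a Stein structure on `F_{g,1} × D² ≅ ♮^{2g} S¹ × B³` (here on
  the concrete `Base g`, which is NOT a Stein domain for the standard `J` of `ℂ²`: `∂ Base g` is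
  Levi-flat along `{‖w‖ = 1/2}`, foliated by the pages) whose contact boundary is supported by the
  trivial open book (Torisu 2000; Eliashberg's filling of `#^{2g} S¹ × S²`, Etnyre 2006, proof of
  Thm. 5.6, first paragraph); (ii) CONVEX-SURFACE THEORY up to the Legendrian realisation principle on
  the double of a page (Honda 2000, Thm. 3.7; Giroux), cf. the merged-back
  `Gompf1998_legendrianRealisation` of `LegendrianRealisation.lean`, already judged a theory there;
  (iii) ELIASHBERG'S 2-HANDLE in the strength of Etnyre's Thm. 5.4 — the new boundary IS the contact
  manifold `(M_{(L,−1)}, ξ_{(L,−1)})` — whereas the tree's E2 `Gompf1998_thm13_twoHandles` concludes only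
  `IsSteinDomain P` (its scope note: *"Only existence of a Stein structure on `P` is asserted, not that
  it extends `S`"*; the complex tangencies of that structure are unidentified), so even
  `Gompf1998_thm13_twoHandles_holds` would not make this fact provable; (iv) COMPATIBILITY of the
  surgered open book with `ξ_{(L,−1)}` (Etnyre Thm. 5.5 = Gay Prop. 2.8: a Reeb field respecting the open
  book, the model `(ℝ³, dz − y dx)/∼`, regluing by `D_L`); (v) infrastructure — transport of Stein
  structures and Giroux forms along diffeomorphisms, isotopy extension from `∂X` over a collar (the
  tree has `IsSteinDomain.of_diffeomorph` for bare existence only).  Items (i)–(iv) are chapters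
  (Cieliebak–Eliashberg 2012; Honda 2000; Etnyre 2006, §§3–5), not M-sized lemmas with locators that
  could be stated here without minting new facts.  Hence, like E2, the fact is KEPT as a cited named
  fact; consumers keep taking `(h : palf_stein_supportedByBoundaryOpenBook)`; a future discharge starts
  from (iii) in Etnyre-5.4 strength and (iv), not from E2 as stated.

## References
* S. Akbulut, B. Ozbagci, *Lefschetz fibrations on compact Stein surfaces*, Geom. Topol. 5 (2001),
  319–334, Thm. 5 and its proof (p. 8 of arXiv:math/0012239). [AkbulutOzbagci2001]
* D. T. Gay, *Explicit concave fillings of contact three-manifolds*, Math. Proc. Camb. Phil. Soc. 133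
  (2002), Def. 2.1 and Prop. 2.8 (arXiv:math/0104059). [Gay2002]
* R. İ. Baykur, *Kähler decomposition of 4-manifolds*, AGT 6 (2006), §2.3, Thm. 2.4, proof of Thm. 5.1
  p. 14 (arXiv:math/0601396). [Baykur2006]
* J. B. Etnyre, *Lectures on open book decompositions and contact structures*, Clay Math. Proc. 5 (2006),
  Thms. 5.4–5.6 (arXiv:math/0409402). [Etnyre2006]
* A. Kas, *On the handlebody decomposition associated to a Lefschetz fibration*, Pacific J. Math. 89
  (1980), 89–104. [Kas1980]
* A. Loi, R. Piergallini, *Compact Stein surfaces with boundary as branched covers of `B⁴`*, Invent.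
  Math. 143 (2001), 325–348, Thm. 1. [LoiPiergallini2001]
* I. Torisu, *Convex contact structures and fibered links in 3-manifolds*, IMRN 2000:9, 441–454 (the
  base case `F × D²`). [Torisu2000]
* K. Honda, *On the classification of tight contact structures I*, Geom. Topol. 4 (2000), 309–368,
  Thm. 3.7 (Legendrian realization principle). [Honda2000]
* R. E. Gompf, *Handlebody construction of Stein surfaces*, Ann. of Math. 148 (1998), Thm. 1.3.
  [Gompf1998]
* K. Cieliebak, Ya. Eliashberg, *From Stein to Weinstein and Back*, AMS Colloquium Publ. 59 (2012),
  Ch. 2 (positivity of the boundary contact structure), Part II (Stein handles). [CieliebakEliashberg2012]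
-/

noncomputable section

open scoped Manifold ContDiff Topology
open Set Function

namespace Literature.Geometry.Symplectic

open Literature.Topology.FourManifolds Literature.Topology.FourManifolds.HandleAttachingMap
  Literature.Topology.FourManifolds.LefschetzBase

/-- The determinant of four vectors of `ℝ⁴` (rows), i.e. the standard volume form of
`ℝ⁴ = ℂ²` (coordinates `(Re x, Im x, Re y, Im y)`: the complex orientation). [folklore] -/
def det4 (a b c d : EuclideanSpace ℝ (Fin 4)) : ℝ :=
  Matrix.det (Matrix.of fun i j : Fin 4 => (![a, b, c, d] i) j)

/-- A tangent vector `v` at a point `q` of the cores-complement `Base g ∖ ⋃ hᵢ(S)` (read in the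
preferred chart of that open submanifold at `q`) as a vector of the ambient `ℝ⁴`: its image under
the differential of the inclusion into `ℝ⁴` (same recipe as `LefschetzBase.ambient`). [folklore] -/
def ambientC {g : ℕ} {ι : Type*} [Finite ι] (h : ι → HandleAttachingMap 3 2 (Base g))
    (q : ↥(coresComplement h)) (v : EuclideanSpace ℝ (Fin 4)) : EuclideanSpace ℝ (Fin 4) :=
  mfderiv (𝓡∂ 4) 𝓘(ℝ, EuclideanSpace ℝ (Fin 4))
    (fun q : ↥(coresComplement h) => ((q : Base g).1 : EuclideanSpace ℝ (Fin 4))) q v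

/-- **Positively oriented boundary frame.**  The triple `(v 0, v 1, v 2)` of tangent vectors at
the point `q` of `Base g ∖ ⋃ hᵢ(S)` is a POSITIVE frame of `∂ Base g` for the boundary
orientation of the complex orientation of `Base g ⊂ ℂ²` (outward normal first): the `4`-frame
`(∇rho, v 0, v 1, v 2)` of `ℝ⁴` has positive determinant (`Base g = {rho ≤ 1/4}`, so `∇rho` is
the outward normal along `∂ Base g = {rho = 1/4}`). [folklore] -/
def IsPosBdryFrame {g : ℕ} {ι : Type*} [Finite ι] (h : ι → HandleAttachingMap 3 2 (Base g))
    (q : ↥(coresComplement h)) (v : Fin 3 → EuclideanSpace ℝ (Fin 4)) : Prop :=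
  0 < det4 (gradient (rho g) (q : Base g).1) (ambientC h q (v 0)) (ambientC h q (v 1))
    (ambientC h q (v 2))


/-- **`ob` is the Kas boundary open book of the Lefschetz
handlebody `X = Base g ∪_{h} (2-handles)` with multi-attachment data `D`, read on a 3-manifold `N`
identified with `∂X` by `incl : N → X`** (Kas 1980; Gompf–Stipsicz 1999 §8.2; Etnyre 2006 §2:
the boundary of a Lefschetz fibration over `D²` with bounded fibres carries the open book whose
pages are the fibres over `∂D²` and whose binding is the boundary of the fibre).  Two clauses:
(K1) the binding of `ob` is exactly the set of points `incl y = D.jA a` of the unsurgered part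
with `w(a) = 0` (the image of the binding `{w = 0} ∩ ∂ Base g` of the base);
(K2) at every point `incl y = D.jA a` of the unsurgered part with `w(a) ≠ 0` the fibration of `ob`
is the page angle: `π(y) = w(a)/‖w(a)‖`.
Since the unsurgered part `incl⁻¹(D.jA(∂ Base g ∖ ⋃ cores))` is dense in `N` (its complement is
the union of the belt circles) and `π` is continuous off the binding, (K1)–(K2) determine `(B, π)`
uniquely off `B`; Giroux's conditions `OpenBook.IsGirouxForm` depend on the tubes of `ob` only
through `(B, π)`, so no clause on the tubes is needed. [cite: Kas1980] -/
def IsKasOpenBookOf (g : ℕ) {ι : Type*} [Finite ι] {X : Type*} [TopologicalSpace X]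
    [ChartedSpace (EuclideanHalfSpace 4) X] (h : ι → HandleAttachingMap 3 2 (Base g))
    (D : MultiAttachmentData h (𝓡∂ 4) X) {N : Type*} [TopologicalSpace N]
    [ChartedSpace (EuclideanSpace ℝ (Fin 3)) N] [IsManifold (𝓡 3) ∞ N] (incl : N → X)
    (ob : OpenBook N) : Prop :=
  (∀ y : N, y ∈ ob.binding ↔
      ∃ a : ↥(coresComplement h), incl y = D.jA a ∧ w g (a : Base g).1 = 0) ∧
  (∀ (y : N) (a : ↥(coresComplement h)), incl y = D.jA a → w g (a : Base g).1 ≠ 0 →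
      toC ((ob.proj y : Metric.sphere (0 : EuclideanSpace ℝ (Fin 2)) 1) : EuclideanSpace ℝ (Fin 2)) =
        w g (a : Base g).1 / (‖w g (a : Base g).1‖ : ℂ))

/-- **PALF ⇒ Stein with the boundary contact structure supported by the Kas open book.**
Akbulut–Ozbagci 2001, Thm. 5 ("every PALF has a Stein structure": induction over the Lefschetz
handles by Torisu's convexity of the fibre, the Legendrian realisation principle and
Eliashberg's theorem) with Gay 2002, Prop. 2.8 (the 2-handle along a page curve with framing
`pf − 1` is a Stein cobordism onto the contact structure supported by the new open book), as
assembled in Baykur 2006, p. 14: *"the PALF on `Xᵢ` … induces an open book decomposition on its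
boundary, and it carries a Stein structure such that the contact structure induced on the boundary
is compatible with this open book"*, and in Etnyre 2006, proof of Thm. 5.6.  Tree rendering: let
`X = Base g ∪_{h} (2-handles)` (Kosinski multi-attachment with data `D`) be a Lefschetz handlebody
over the standard base which is POSITIVE and ALLOWABLE — each attaching circle lies in a page
`page g c` of `∂ Base g`, has page twisting `−1` (framing "one less than the page framing") and
non-zero homology shadow (equivalently: is non-separating in the page) — and let `ob` be its Kas
boundary open book on a boundary datum `bX` (`IsKasOpenBookOf`).  Then `X` carries a Stein
structure `S` whose complex tangencies `ξ = boundaryPlaneField S.J bX` of `∂X` are supported by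
`ob` through a Giroux form `α` (Etnyre's "supported after an isotopy of `ξ`" is absorbed into the
choice of `S`: pull `S` back along a diffeomorphism of `X` extending the isotopy), and `ξ` is a
POSITIVE contact structure for the boundary orientation of the complex (= PALF) orientation of
`X` (Baykur 2006 §2.3; Etnyre 2006 §5): `α ∧ dα > 0` on every frame of `T_y ∂X` which corresponds,
under `d(bX.incl)` and `d(D.jA)`, to a positively oriented frame of `∂ Base g ⊂ ℂ²` at a point of
the unsurgered part.  (Review 2026-08-17, module docstring: in the sources, faithfully rendered, not
mis-cut, irreducibly XL — kept as a cited named fact; users take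
`(h : palf_stein_supportedByBoundaryOpenBook)`.) [cite: AkbulutOzbagci2001, Thm. 5]
[cite: Etnyre2006, Thms. 5.4–5.6] [cite: Gay2002, Prop. 2.8] -/
def palf_stein_supportedByBoundaryOpenBook : Prop :=
  ∀ (g : ℕ) (ι : Type) [Finite ι] (X : Type) [TopologicalSpace X] [T2Space X]
    [SecondCountableTopology X] [CompactSpace X] [ChartedSpace (EuclideanHalfSpace 4) X]
    [IsManifold (𝓡∂ 4) ∞ X]
    (h : ι → HandleAttachingMap 3 2 (Base g)) (D : MultiAttachmentData h (𝓡∂ 4) X)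
    (bX : BoundaryData (𝓡∂ 4) X (𝓡 3)) (ob : OpenBook bX.carrier),
    (∀ i, ∃ c : ℂ, ‖c‖ = 1 ∧ ∀ θ, (h i).attachingCircle θ ∈ page g c) →
    (∀ i, shadow g (h i).attachingCircle (h i).continuous_attachingCircle ≠ 0) →
    (∀ i, pageTwisting g (h i).attachingCircle (h i).attachingFraming = -1) →
    IsKasOpenBookOf g h D bX.incl ob →
    ∃ (S : SteinStructure X) (α : Literature.Geometry.Kaehler.MForm (𝓡 3) bX.carrier ℝ 1),
      ob.IsGirouxForm (boundaryPlaneField S.J bX) α ∧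
      ∀ (y : bX.carrier) (a : ↥(coresComplement h)) (u : Fin 3 → EuclideanSpace ℝ (Fin 3))
        (v : Fin 3 → EuclideanSpace ℝ (Fin 4)),
        bX.incl y = D.jA a →
        (∀ k, mfderiv (𝓡 3) (𝓡∂ 4) bX.incl y (u k) = mfderiv (𝓡∂ 4) (𝓡∂ 4) D.jA a (v k)) →
        IsPosBdryFrame h a v →
        0 < wedge₁₂ (α y) (Literature.Geometry.Kaehler.mextDeriv α y) (u 0) (u 1) (u 2)

end Literature.Geometry.Symplectic

end
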